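import Summits.QuantumFields.YangMills.Theorems.BalabanUVNodesK0Stub1CorrectedCurrentWeightedLetter
import Summits.QuantumFields.YangMills.Theorems.BalabanUVNodesK0Stub1H128OfRecordCriticality

/-!
# K0⁷ STUB 1 (`stub_prop8StepCoP13`), sub-target S4a — **`h128` FROM THE RECORD's CRITICALITY SOCKET, WITH THE k-UNIFORM SUP LETTER OF THE CORRECTED CURRENT**
# (p620347 `exists_correctedCurrent_of_slice(_lieSU)` ⊕ the letters of `…K0Stub1CorrectedCurrentLetter` ∕ `…K0Stub1CorrectedCurrentWeightedLetter`:
# `‖(RᵀW)(b)‖ ≤ 12·d·(d+2)·L·sup‖W‖` and, in the (98) currency, `w_m(b′)‖(RᵀW)(b′)‖ ≤ 12·d·(d+2)·L·L^m·sup_b w_m(b)‖W(b)‖`)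

Cell `pub-ymgap`, width seat `pub-ymgap-k0-s1-w1` g6 (CLAIM-1 file 3∕3, re-based on CLAIM-2; the located on-path S4a item (t3) of HOME `HANDOFF.md` § g5 + k0-s1-w2 g4's ask for the
weighted edition).  `--kind proof --supports stmt-QuantumFields-20541 --as helper`; count-neutral.  [15] = [Balaban1985Variational]; [B6] = [Balaban1984PropagatorsII].

WHY.  p620347 is the consumer-facing end of the corrected-current chain: (hK)∕(hDK) discharged at model level for lit-balaban's `dcsE c ∘ dcE c` ∕ `deltaAE` extensions under the
slice (153), only the SOCKET `h127rec` displayed.  Its `Rᵀ` came from p618723, whose ∃ records no size letter; the (98) sup slot of the heart ([15] p.292) through which the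
corrected current `W′ = W + RᵀW` is consumed (p604735 `letter165_rows_of_critical128_bodyAt`, `hWq`∕`C₄`, level weights `w 3`) needs one.  THIS FILE re-runs p620347's two
five-line wrappers over `…CorrectedCurrentLetter.exists_correctedCurrent_letter` (plain tests: the unweighted letter) and `…CorrectedCurrentWeightedLetter.exists_correctedCurrent_letters_lieSU`
(𝔰𝔲(N) tests: BOTH letters), so that the SAME `(T, Rᵀ)` carry `‖(RᵀW)(b)‖ ≤ 12·d·(d+2)·L·s` (`‖W(b)‖ ≤ s`) and `w_m(b′)‖(RᵀW)(b′)‖ ≤ 12·d·(d+2)·L·L^m·s` (`w_m(b)‖W(b)‖ ≤ s`,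
`w_m(b) = (L^{levOf b₋}(L⁻¹)^{k′})^m`): with `w₃(b)‖W(b)‖ ≤ C₄ρ²` the corrected current obeys `w₃(b)‖W′(b)‖ ≤ (1 + 12d(d+2)L⁴)·C₄ρ²`, uniformly in `k` and `N`.

WHAT IS PROVED (sorry-free; no definition; axioms standard).  ★★★ `exists_correctedCurrent_of_slice_letter` — p620347's plain-test statement verbatim (hypothesis `2 ≤ P.d`) + the
unweighted letter as fifth conjunct; ★★★ `exists_correctedCurrent_of_slice_letters_lieSU` — p620347's 𝔰𝔲(N) statement verbatim + the unweighted (fifth) AND the weighted (sixth)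
letter; ★ `norm_correctedCurrent_le` ∕ ★ `weight_norm_correctedCurrent_le` — the bookkeeping `‖W + RᵀW‖ ≤ (1 + C)s` plain ∕ weighted; `two_le_d_T4` (`2 ≤ (F.P K).d`).

HONEST SCOPE.  Wrappers BY NAME over p620347 §1–§2 (`pairing_grad_curlCurlExt_eq_zero`, `pairing_deltaAEExt_eq_pairing_curlCurlExt`) and the two letter files; NO estimate of Bałaban's
asserted; the SOCKET `h127rec` is NOT produced here (S2∕S4b); `stub_prop8StepCoP13` ∕ K0⁷ NOT closed; N07 NOT discharged; counts unmoved (28∕28 · 5∕27); one finite 𝕋⁴ programme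
at fixed ε — R4 closes the conditional finite-𝕋⁴ rung `BalabanLadder.UV` only, never the summit; the YM mass gap (Clay) is NOT proved by any of this; nothing continuum ∕ ℝ⁴ ∕ OS.
No `sorry`, no `def`, no `instance`, no `notation`.

References: [15] (98) p.292, (127)–(128) p.297, (153) p.301, (158) p.302, (165) p.303; [B6] (2.19)–(2.20) p.226.
-/

set_option autoImplicit false
noncomputable section
open scoped BigOperators Matrix Matrix.Norms.L2Operator

namespace Summit.QuantumFields.YangMills.Theorems.K0Stub1H128OfRecordCriticalityLetter

open Literature.MathematicalPhysics.QuantumFieldTheory.Balaban1983to89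
open B6SectADomainsV1 (Domains)
open B6SectAOperatorsV1 (BondIdx QE RE dsE dcE dcsE)
open B6SectAVectorModelV1 (deltaAE)
open Node00 (dIterL)
open T4AdjointCovarianceUnitary (lieSU)
open Summit.QuantumFields.YangMills.Theorems.K0Stub1H128OfRecordCriticality (pairing_grad_curlCurlExt_eq_zero pairing_deltaAEExt_eq_pairing_curlCurlExt)
open B11Eq115Space (levOf)
open Summit.QuantumFields.YangMills.Theorems.K0Stub1CorrectedCurrentLetter (exists_correctedCurrent_letter)
open Summit.QuantumFields.YangMills.Theorems.K0Stub1CorrectedCurrentWeightedLetter (exists_correctedCurrent_letters_lieSU)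

variable {P : Params} {N : ℕ}

/-- ★ **THE (98)-SLOT BOOKKEEPING**: `‖W(b)‖ ≤ s` for all `b` and `‖(RᵀW)(b)‖ ≤ C·s` give `‖W(b) + (RᵀW)(b)‖ ≤ (1 + C)·s`. [cite: Balaban1985Variational, (98) p.292] -/
theorem norm_correctedCurrent_le {Rt : (PBond P 0 → Matrix (Fin N) (Fin N) ℂ) → PBond P 0 → Matrix (Fin N) (Fin N) ℂ} {C s : ℝ}
    (hRt : ∀ (W : PBond P 0 → Matrix (Fin N) (Fin N) ℂ) (s : ℝ), 0 ≤ s → (∀ b, ‖W b‖ ≤ s) → ∀ b, ‖Rt W b‖ ≤ C * s)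
    {W : PBond P 0 → Matrix (Fin N) (Fin N) ℂ} (hs : 0 ≤ s) (hW : ∀ b, ‖W b‖ ≤ s) (b : PBond P 0) :
    ‖W b + Rt W b‖ ≤ (1 + C) * s :=
  (norm_add_le _ _).trans (by rw [add_mul, one_mul]; exact add_le_add (hW b) (hRt W s hs hW b))

/-- ★ **THE WEIGHTED (98)-SLOT BOOKKEEPING**: `ω(b)‖W(b)‖ ≤ s` for all `b` and `ω(b)‖(RᵀW)(b)‖ ≤ C·s` give `ω(b)‖W(b) + (RᵀW)(b)‖ ≤ (1 + C)·s` (`ω ≥ 0`).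
[cite: Balaban1985Variational, (98) p.292] -/
theorem weight_norm_correctedCurrent_le {Rt : (PBond P 0 → Matrix (Fin N) (Fin N) ℂ) → PBond P 0 → Matrix (Fin N) (Fin N) ℂ} {ω : PBond P 0 → ℝ} {C s : ℝ}
    (hω : ∀ b, 0 ≤ ω b)
    (hRt : ∀ (W : PBond P 0 → Matrix (Fin N) (Fin N) ℂ) (s : ℝ), 0 ≤ s → (∀ b, ω b * ‖W b‖ ≤ s) → ∀ b, ω b * ‖Rt W b‖ ≤ C * s)
    {W : PBond P 0 → Matrix (Fin N) (Fin N) ℂ} (hs : 0 ≤ s) (hW : ∀ b, ω b * ‖W b‖ ≤ s) (b : PBond P 0) :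
    ω b * ‖W b + Rt W b‖ ≤ (1 + C) * s := by
  calc ω b * ‖W b + Rt W b‖ ≤ ω b * (‖W b‖ + ‖Rt W b‖) := mul_le_mul_of_nonneg_left (norm_add_le _ _) (hω b)
    _ = ω b * ‖W b‖ + ω b * ‖Rt W b‖ := mul_add _ _ _
    _ ≤ s + C * s := add_le_add (hW b) (hRt W s hs hW b)
    _ = (1 + C) * s := by ring

/-- At the record's tori `d = 4`, so the hypothesis `2 ≤ d` of the letter holds (`T4Family.P_d`). [cite: Balaban1987RG1, (0.1) p.251] -/
theorem two_le_d_T4 (F : T4Continuum.T4Family) (K : ℕ) : 2 ≤ (F.P K).d := by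
  rw [T4Continuum.T4Family.P_d]; norm_num

section Junction

variable [NeZero N] (D : Domains P)
  (hcollar : ∀ (i : ℕ) (e : PBond P (i + 1)), D.LamBond (i + 1) e → ∀ z : Site P i, (blockOf z = e.src ∨ blockOf z = e.tgt) → z ∈ D.Om i)

include hcollar in
/-- ★★★ **p595460's `h128` FROM THE RECORD's CRITICALITY SOCKET + THE SLICE, WITH THE k-UNIFORM SUP LETTER OF `Rᵀ`** (p620347 `exists_correctedCurrent_of_slice` verbatim
+ fifth conjunct `‖(RᵀW)(b)‖ ≤ 12·d·(d+2)·L·s`; `d ≥ 2`). [cite: Balaban1985Variational, (98) p.292, (127)-(128) p.297, (153) p.301, (158) p.302; Balaban1984PropagatorsII, (2.19)-(2.20) p.226] -/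
theorem exists_correctedCurrent_of_slice_letter (hd : 2 ≤ P.d) :
    ∃ (T : (PBond P 0 → Matrix (Fin N) (Fin N) ℂ) →ₗ[ℂ] (Site P 0 → Matrix (Fin N) (Fin N) ℂ))
      (Rt : (PBond P 0 → Matrix (Fin N) (Fin N) ℂ) →ₗ[ℝ] (PBond P 0 → Matrix (Fin N) (Fin N) ℂ)),
      (∀ Z : PBond P 0 → Matrix (Fin N) (Fin N) ℂ, (∀ b, (Z b)ᴴ = -Z b) → ∀ x, (T Z x)ᴴ = -T Z x) ∧
      (∀ (Z : PBond P 0 → Matrix (Fin N) (Fin N) ℂ) (s : ℝ), 0 ≤ s → (∀ b, ‖Z b‖ ≤ s) →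
        ∀ x, ‖T Z x‖ ≤ ((P.d + 2 : ℕ) : ℝ) * (P.L : ℝ) ^ (D.k + 1) * s) ∧
      (∀ W b, (Rt W b)ᴴ = -(Rt W b)) ∧
      (∀ δ W : PBond P 0 → Matrix (Fin N) (Fin N) ℂ, (∀ b, (δ b)ᴴ = -δ b) →
        ∑ b, ((δ b)ᴴ * Rt W b).trace.re = ∑ b, ((T δ b.tgt - T δ b.src)ᴴ * W b).trace.re) ∧
      (∀ (W : PBond P 0 → Matrix (Fin N) (Fin N) ℂ) (s : ℝ), 0 ≤ s → (∀ b, ‖W b‖ ≤ s) →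
        ∀ b, ‖Rt W b‖ ≤ 12 * P.d * (((P.d + 2) * P.L : ℕ) : ℝ) * s) ∧
      ∀ {instDE : DecidableEq (PBond P 0)} {DV KV : (PBond P 0 → Matrix (Fin N) (Fin N) ℂ) →ₗ[ℂ] (PBond P 0 → Matrix (Fin N) (Fin N) ℂ)}
        {QV : (PBond P 0 → Matrix (Fin N) (Fin N) ℂ) →ₗ[ℂ] (BondIdx D → Matrix (Fin N) (Fin N) ℂ)} (c : ℝ) (w : BondIdx D → ℝ),
        (∀ (A : PBond P 0 → Matrix (Fin N) (Fin N) ℂ) (b : PBond P 0),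
          DV A b = ∑ j, ((WithLp.ofLp (deltaAE D c w (WithLp.toLp 2 (Pi.single j 1))) b : ℝ) : ℂ) • A j) →
        (∀ (A : PBond P 0 → Matrix (Fin N) (Fin N) ℂ) (b : PBond P 0),
          KV A b = ∑ j, ((WithLp.ofLp ((dcsE c ∘ₗ dcE c) (WithLp.toLp 2 (Pi.single j 1))) b : ℝ) : ℂ) • A j) →
        (∀ (A : PBond P 0 → Matrix (Fin N) (Fin N) ℂ) (t : BondIdx D),
          QV A t = ∑ j, ((WithLp.ofLp (QE D (WithLp.toLp 2 (Pi.single j 1))) t : ℝ) : ℂ) • A j) →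
        ∀ (A' Wf : PBond P 0 → Matrix (Fin N) (Fin N) ℂ),
          (∀ φ : Matrix (Fin N) (Fin N) ℂ →L[ℂ] ℂ, RE D c (dsE c (WithLp.toLp 2 (fun b => (φ (A' b)).re))) = 0) →
          (∀ δ : PBond P 0 → Matrix (Fin N) (Fin N) ℂ, (∀ b, (δ b)ᴴ = -δ b) →
            (∀ (j : ℕ) (e : PBond P j), D.LamBond j e → dIterL j (1 : PBond P 0 → Matrix (Fin N) (Fin N) ℂ) δ e = 0) →
            ∑ b, ((δ b)ᴴ * (KV A' b + Wf b)).trace.re = 0) →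
          ∀ δ : PBond P 0 → Matrix (Fin N) (Fin N) ℂ, (∀ b, (δ b)ᴴ = -δ b) → QV δ = 0 →
            ∑ b, ((δ b)ᴴ * (DV A' b + (Wf b + Rt Wf b))).trace.re = 0 := by
  obtain ⟨T, Rt, h1, h2, h3, h4, h5, hj⟩ := exists_correctedCurrent_letter (N := N) D hcollar hd
  refine ⟨T, Rt, h1, h2, h3, h4, h5, ?_⟩
  intro instDE DV KV QV c w hDV hKV hQV A' Wf hslice h127 δ hδ hQ
  exact hj hQV (DV A') (KV A') Wf (fun μ _ => pairing_grad_curlCurlExt_eq_zero c hKV μ A')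
    (fun δ' _ hQ' => pairing_deltaAEExt_eq_pairing_curlCurlExt D c w hDV hKV hQV hslice hQ') h127 δ hδ hQ

include hcollar in
/-- ★★★ **THE SAME WITH 𝔰𝔲(N)-VALUED TESTS ON BOTH SIDES AND BOTH LETTERS** (p620347 `exists_correctedCurrent_of_slice_lieSU` verbatim + the unweighted letter + the
WEIGHTED letter in the (98)∕(152) currency `w_m(b) = (L^{levOf b₋}·(L⁻¹)^{k′})^m`; p604735's `h128` shape, dag-n07-w1's socket convention `qLin j 1 δ = dIterL j 1 ↑δ`).
[cite: Balaban1985Variational, (98) p.292, (127)-(128) p.297, (3)-(4) p.278, (152) p.301, (153) p.301; Balaban1984PropagatorsII, (2.19)-(2.20) p.226] -/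
theorem exists_correctedCurrent_of_slice_letters_lieSU (hd : 2 ≤ P.d) :
    ∃ (T : (PBond P 0 → Matrix (Fin N) (Fin N) ℂ) →ₗ[ℂ] (Site P 0 → Matrix (Fin N) (Fin N) ℂ))
      (Rt : (PBond P 0 → Matrix (Fin N) (Fin N) ℂ) →ₗ[ℝ] (PBond P 0 → Matrix (Fin N) (Fin N) ℂ)),
      (∀ Z : PBond P 0 → Matrix (Fin N) (Fin N) ℂ, (∀ b, Z b ∈ lieSU (Fin N)) → ∀ x, T Z x ∈ lieSU (Fin N)) ∧
      (∀ (Z : PBond P 0 → Matrix (Fin N) (Fin N) ℂ) (s : ℝ), 0 ≤ s → (∀ b, ‖Z b‖ ≤ s) →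
        ∀ x, ‖T Z x‖ ≤ ((P.d + 2 : ℕ) : ℝ) * (P.L : ℝ) ^ (D.k + 1) * s) ∧
      (∀ W b, (Rt W b)ᴴ = -(Rt W b)) ∧
      (∀ δ W : PBond P 0 → Matrix (Fin N) (Fin N) ℂ, (∀ b, (δ b)ᴴ = -δ b) →
        ∑ b, ((δ b)ᴴ * Rt W b).trace.re = ∑ b, ((T δ b.tgt - T δ b.src)ᴴ * W b).trace.re) ∧
      (∀ (W : PBond P 0 → Matrix (Fin N) (Fin N) ℂ) (s : ℝ), 0 ≤ s → (∀ b, ‖W b‖ ≤ s) →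
        ∀ b, ‖Rt W b‖ ≤ 12 * P.d * (((P.d + 2) * P.L : ℕ) : ℝ) * s) ∧
      (∀ (m k' : ℕ) (W : PBond P 0 → Matrix (Fin N) (Fin N) ℂ) (s : ℝ), 0 ≤ s →
        (∀ b : PBond P 0, ((P.L : ℝ) ^ levOf (fun i => {y : Site P 0 | D.InOm i y}) D.k b.src * ((P.L : ℝ)⁻¹) ^ k') ^ m * ‖W b‖ ≤ s) →
        ∀ b : PBond P 0, ((P.L : ℝ) ^ levOf (fun i => {y : Site P 0 | D.InOm i y}) D.k b.src * ((P.L : ℝ)⁻¹) ^ k') ^ m * ‖Rt W b‖ ≤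
          12 * P.d * (((P.d + 2) * P.L : ℕ) : ℝ) * (P.L : ℝ) ^ m * s) ∧
      ∀ {instDE : DecidableEq (PBond P 0)} {DV KV : (PBond P 0 → Matrix (Fin N) (Fin N) ℂ) →ₗ[ℂ] (PBond P 0 → Matrix (Fin N) (Fin N) ℂ)}
        {QV : (PBond P 0 → Matrix (Fin N) (Fin N) ℂ) →ₗ[ℂ] (BondIdx D → Matrix (Fin N) (Fin N) ℂ)} (c : ℝ) (w : BondIdx D → ℝ),
        (∀ (A : PBond P 0 → Matrix (Fin N) (Fin N) ℂ) (b : PBond P 0),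
          DV A b = ∑ j, ((WithLp.ofLp (deltaAE D c w (WithLp.toLp 2 (Pi.single j 1))) b : ℝ) : ℂ) • A j) →
        (∀ (A : PBond P 0 → Matrix (Fin N) (Fin N) ℂ) (b : PBond P 0),
          KV A b = ∑ j, ((WithLp.ofLp ((dcsE c ∘ₗ dcE c) (WithLp.toLp 2 (Pi.single j 1))) b : ℝ) : ℂ) • A j) →
        (∀ (A : PBond P 0 → Matrix (Fin N) (Fin N) ℂ) (t : BondIdx D),
          QV A t = ∑ j, ((WithLp.ofLp (QE D (WithLp.toLp 2 (Pi.single j 1))) t : ℝ) : ℂ) • A j) →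
        ∀ (A' Wf : PBond P 0 → Matrix (Fin N) (Fin N) ℂ),
          (∀ φ : Matrix (Fin N) (Fin N) ℂ →L[ℂ] ℂ, RE D c (dsE c (WithLp.toLp 2 (fun b => (φ (A' b)).re))) = 0) →
          (∀ δ : PBond P 0 → lieSU (Fin N),
            (∀ (j : ℕ) (e : PBond P j), D.LamBond j e →
              dIterL j (1 : PBond P 0 → Matrix (Fin N) (Fin N) ℂ) (fun b => (δ b : Matrix (Fin N) (Fin N) ℂ)) e = 0) →
            ∑ b, (((δ b : Matrix (Fin N) (Fin N) ℂ))ᴴ * (KV A' b + Wf b)).trace.re = 0) →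
          ∀ δ : PBond P 0 → lieSU (Fin N), QV (fun b => (δ b : Matrix (Fin N) (Fin N) ℂ)) = 0 →
            ∑ b, (((δ b : Matrix (Fin N) (Fin N) ℂ))ᴴ * (DV A' b + (Wf b + Rt Wf b))).trace.re = 0 := by
  obtain ⟨T, Rt, h1, h2, h3, h4, h5, h6, hj⟩ := exists_correctedCurrent_letters_lieSU (N := N) D hcollar hd
  refine ⟨T, Rt, h1, h2, h3, h4, h5, h6, ?_⟩
  intro instDE DV KV QV c w hDV hKV hQV A' Wf hslice h127 δ hQ
  exact hj hQV (DV A') (KV A') Wf (fun μ => pairing_grad_curlCurlExt_eq_zero c hKV (fun x => (μ x : Matrix (Fin N) (Fin N) ℂ)) A')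
    (fun δ' hQ' => pairing_deltaAEExt_eq_pairing_curlCurlExt D c w hDV hKV hQV hslice hQ') h127 δ hQ

end Junction

end Summit.QuantumFields.YangMills.Theorems.K0Stub1H128OfRecordCriticalityLetter

end
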